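import Mathlib
import Summits.Ventures.HodgeRepro.Tier4.Common.LocalCoordinatesConj
import Summits.Ventures.HodgeRepro.Tier4.Line4.D3Coeff
import Summits.Ventures.HodgeRepro.Tier4.Line4.D3CoeffConj
import Summits.Ventures.HodgeRepro.Tier4.Line4.D3CoeffDelta
import Summits.Ventures.HodgeRepro.Tier4.Line4.D3CoeffDecayDefinite

/-!
# Tier4/Line4/DefiniteCoeff — C-L4-DEFCOEFF: the `(p, m)`-weight coefficient of the compact `U(2)_w` at a DEFINITE
real CM place, in the `T′`-adapted coordinates of the seesaw plane, with the `equiv` law of `IsArchCoeff` at `w` for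
ARBITRARY displayed weights `(eP′ w, eM′ w) = (p, m)`

Blind re-derivation cell `pub-hodge-repro`, Tier 4 (README §9–§10), seat t4-L1-p5 (prover, gen 5; plan-4 g4's answer
(b) S15084 / the (7a) docstring of LINE L4 v0.34 L1139–L1141: «at `w′ ≠ w₀` the factor is the `(eP′ w′, eM′ w′)`-weight
matrix coefficient of the `U(2)_{w′}`-representation … unitary, `‖·‖ ≤ 1`, `equiv` by construction for the DISPLAYED
integers `eP′ eM′`»; the recipe of the seat's CLOSE line S15105 (2); lead S15113 / STARTED S15129).  Target tree path
`lean/Summits/Ventures/HodgeRepro/Tier4/Line4/DefiniteCoeff.lean`.  On typer-2's `Common/LocalCoordinatesConj` (p700125: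
`locEntry'`, `conjTo`, `weightAt'_eq_weightAt_conjTo`, `conjTo_mem_torusT_of_mem_torusT'`) and the seat's `D3Coeff`
(p699431: the `(0,0)` torus laws), `D3CoeffConj` (p700675: `weightAt'_inv_of_mem_torusT'`, `conj_weightAt'_of_mem_torusT'`),
`D3CoeffDelta` (p702993: the `(1,1)` torus laws), `D3CoeffDecayDefinite` (p702693: `normSq_locEntry_le_of_definite`,
the `U(2)` bounds `‖α′‖, ‖δ′‖ ≤ 1` at a definite place); no printed input.

THE OBJECT.  For `p : ℤ` write `p₊ := p.toNat = max p 0`, `p₋ := (−p).toNat = max (−p) 0`, so `p₊ − p₋ = p`, and for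
`z : ℂ` the **weight-`p` monomial** `wtMono p z := conj z ^ p₊ · z ^ p₋`.  With `α′ = locEntry' x 0 0`, `δ′ = locEntry' x 1 1`
the diagonal `T′`-adapted coordinates of the `w`-block of `x` (the `w`-block of `g′ x g` in the second row plane), the
**`(p, m)`-weight coefficient at `w`** is
`defCoeff w p m x := wtMono p α′(x) · wtMono m δ′(x) = conj(α′)^{p₊} (α′)^{p₋} conj(δ′)^{m₊} (δ′)^{m₋}`.
Representation-theoretic reading (NOT used by any kernel clause): with `V` the standard representation of the compact
`U(2)_w`, `α′ = ⟨x e₀, e₀⟩`, `δ′ = ⟨x e₁, e₁⟩`, this is the matrix coefficient of the tensor power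
`V^{⊗p₋} ⊗ V̄^{⊗p₊} ⊗ V^{⊗m₋} ⊗ V̄^{⊗m₊}` on the extremal weight vector `e₀^{⊗p₋} ⊗ ē₀^{⊗p₊} ⊗ e₁^{⊗m₋} ⊗ ē₁^{⊗m₊}` of
torus weight `(−p, −m)`, which generates the irreducible `Sym^{|p−m|} ⊗ det^{…}`-constituent plan-4 names; the kernel
content is the four clauses below.

WHAT IS PROVED (kernel; by name on the landed modules, no print).
* `wtMono_one`, `continuous_wtMono`, `norm_wtMono_le_one` (`‖z‖ ≤ 1 ⇒ ‖wtMono p z‖ ≤ 1`), and **`wtMono_unit_mul`**: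
  `wtMono p (u z) = u ^ (−p) · wtMono p z` whenever `conj u = u⁻¹` and `u ≠ 0` — the one algebraic identity behind the
  equivariance (`conj(u)^{p₊} u^{p₋} = u^{p₋ − p₊} = u^{−p}`).
* the `T′`-laws of the diagonal coordinates: `locEntry'_zero_zero_torus'_mul` / `locEntry'_one_one_torus'_mul`
  (`α′(κ x) = u₀(κ) α′(x)`, `δ′(κ x) = u₁(κ) δ′(x)` for `κ ∈ T′(𝔸)`, `u_j = weightAt' … j`) and the right twins;
  `norm_weightAt'_eq_one_of_mem_torusT'`, `weightAt'_ne_zero_of_mem_torusT'`.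
* `defCoeff_one`; **`continuous_defCoeff`** (unconditional: `locEntry'` is continuous);
  **`norm_defCoeff_le_one`** at a DEFINITE place (`(a 1)_w · (−a 3)_w > 0`): `‖defCoeff w p m x‖ ≤ 1`, uniformly in `x`
  (the `U(2)` bounds `‖α′‖, ‖δ′‖ ≤ 1` of `normSq_locEntry_le_of_definite`);
* **`defCoeff_torus'_mul`** / `defCoeff_mul_torus'` — the `T′`-equivariance on both sides:
  `defCoeff w p m (κ x) = u₀(κ)^{−p} · u₁(κ)^{−m} · defCoeff w p m x` for `κ ∈ T′(𝔸)` (and the same on the right);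
* **`cj_defCoeff_inv_mul`** — THE `equiv` FIELD OF `IsArchCoeff` AT `w` WITH `(eP′ w, eM′ w) = (p, m)`: for
  `κ ∈ localTorusAt' W w` and every `y`,
  `RTF.cj (defCoeff w p m) (κ⁻¹ y) = weightAt' … 0 κ ^ (−p) · weightAt' … 1 κ ^ (−m) · RTF.cj (defCoeff w p m) y`
  — the clause verbatim for ARBITRARY displayed integers `p m` (`D3coeff'` / `D3coeff''` are the `(3, 0)` / `(0, 3)`
  instances of the same law on the inverse powers, p700675 / p702993);
* `locEntry'_mul_of_mem_localTorusAt'_ne`, **`defCoeff_mul_of_mem_localTorusAt'_ne`** — the local tori of the OTHER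
  places act trivially (`defCoeff w` reads the `w`-block only): the `equiv` clause of the `w`-factor at `w′ ≠ w`.

HOW (7a) CONSUMES IT.  The archimedean witness of `D3CoeffData'` is the product over the infinite places of the
`w₀`-factor (`D3coeff'` or `D3coeff''` by the sign in `_he'`) and, at every place `w′ ≠ w₀`, `defCoeff w′ (eP′ w′) (eM′ w′)`;
`cj_defCoeff_inv_mul` at `w′` together with the triviality lemmas of the other factors is `equiv` at `w′`, and
`norm_defCoeff_le_one` keeps the decay bound of the `w₀`-factor (`hasDecay3_D3coeff'_of_definite`, p702693) for the
product.  NOT here: the local twisted integral `≠ 0` at a definite place (the `arch_ne` matching, displayed), the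
`G_∞`-integrability and the operator Schur clauses (print, displayed in the line).  Nothing here says anything about the
status of the Hodge conjecture for CM abelian varieties, which is NOT proved (HC_CM is NOT proved by anyone in this
repository).
-/

set_option autoImplicit false

noncomputable section

namespace Summit.Ventures.HodgeRepro.Tier4.Line4

open Summit.Ventures.HodgeRepro.Tier4.Common Summit.Ventures.HodgeRepro.Tier4.Line1 NumberField Matrix

open scoped ComplexConjugate

section WeightMonomial

/-- **the weight-`p` monomial** in `z : ℂ`: `conj z ^ p₊ · z ^ p₋` with `p₊ = p.toNat`, `p₋ = (−p).toNat`
(`p₊ − p₋ = p`); under `z ↦ u z` with `u` unitary it picks up `u ^ (−p)` (`wtMono_unit_mul`). -/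
def wtMono (p : ℤ) (z : ℂ) : ℂ := conj z ^ p.toNat * z ^ (-p).toNat

/-- `wtMono p 1 = 1`. -/
theorem wtMono_one (p : ℤ) : wtMono p 1 = 1 := by
  simp [wtMono]

/-- `wtMono p` is continuous. -/
theorem continuous_wtMono (p : ℤ) : Continuous (wtMono p) :=
  (Complex.continuous_conj.pow _).mul (continuous_id.pow _)

/-- `‖z‖ ≤ 1 ⇒ ‖wtMono p z‖ ≤ 1`. -/
theorem norm_wtMono_le_one (p : ℤ) {z : ℂ} (hz : ‖z‖ ≤ 1) : ‖wtMono p z‖ ≤ 1 := by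
  unfold wtMono
  rw [norm_mul, norm_pow, norm_pow, Complex.norm_conj]
  exact mul_le_one₀ (pow_le_one₀ (norm_nonneg _) hz) (by positivity) (pow_le_one₀ (norm_nonneg _) hz)

/-- **the unit-twist law**: `wtMono p (u · z) = u ^ (−p) · wtMono p z` when `conj u = u⁻¹` and `u ≠ 0`
(`conj(u)^{p₊} · u^{p₋} = u^{p₋ − p₊} = u^{−p}`). -/
theorem wtMono_unit_mul (p : ℤ) {u : ℂ} (hu : conj u = u⁻¹) (hu0 : u ≠ 0) (z : ℂ) :
    wtMono p (u * z) = u ^ (-p) * wtMono p z := by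
  have key : u⁻¹ ^ p.toNat * u ^ (-p).toNat = u ^ (-p) := by
    rw [inv_pow, ← zpow_natCast, ← zpow_natCast u, ← _root_.zpow_neg, ← zpow_add₀ hu0]
    congr 1
    linear_combination (-1 : ℤ) * Int.toNat_sub_toNat_neg p
  unfold wtMono
  rw [map_mul, mul_pow, mul_pow, hu, ← key]
  ring

end WeightMonomial

section DefCoeff

variable {k : Type} [Field k] [NumberField k] (q : QuadData k) (a : Fin 4 → k)
  (g g' : Matrix (Fin 4) (Fin 4) k) (hgg' : g * g' = 1) (hg'g : g' * g = 1)
  (hgΩ : g * (PlaneData.mixedRow q (a 0) (a 2)).Ω = (PlaneData.mixedRow q (a 0) (a 2)).Ω * g)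
  (lam : k) (hlam : lam ≠ 0)
  (hiso : g * (PlaneData.mixedRow q (a 1) (a 3)).B * gᵀ = lam • (PlaneData.mixedRow q (a 0) (a 2)).B)
  (w : InfinitePlace k)

include hlam in
/-- **`α′(κ x) = u₀(κ) · α′(x)`** for `κ ∈ T′(𝔸)`, `u₀ = weightAt' … 0` (the `(0,0)` law of `D3Coeff` at the conjugate). -/
theorem locEntry'_zero_zero_torus'_mul (hw : w.IsReal) (hcm : IsCMAt q w) (ha1 : a 1 ≠ 0) (ha3 : a 3 ≠ 0)
    (x κ : GA ((PlaneData.mixedRow q (a 0) (a 2)).withTransportedTorus g g' hgg' hg'g hgΩ))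
    (hκ : κ ∈ torusT' ((PlaneData.mixedRow q (a 0) (a 2)).withTransportedTorus g g' hgg' hg'g hgΩ)) :
    locEntry' q a g g' hgg' hg'g hgΩ lam hiso w (κ * x) 0 0 =
      weightAt' ((PlaneData.mixedRow q (a 0) (a 2)).withTransportedTorus g g' hgg' hg'g hgΩ) q w g g' 0 κ *
        locEntry' q a g g' hgg' hg'g hgΩ lam hiso w x 0 0 := by
  rw [weightAt'_eq_weightAt_conjTo q a g g' hgg' hg'g hgΩ lam hiso]
  unfold locEntry'
  rw [conjTo_mul]
  exact locEntry_zero_zero_mul_of_mem_torusT q (a 1) (a 3) (-1) w hw hcm ha1 ha3 (by norm_num) _ _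
    (conjTo_mem_torusT_of_mem_torusT' q a g g' hgg' hg'g hgΩ lam hlam hiso hκ)

include hlam in
/-- **`α′(x κ) = α′(x) · u₀(κ)`** for `κ ∈ T′(𝔸)`. -/
theorem locEntry'_zero_zero_mul_torus' (hw : w.IsReal) (hcm : IsCMAt q w) (ha1 : a 1 ≠ 0) (ha3 : a 3 ≠ 0)
    (x κ : GA ((PlaneData.mixedRow q (a 0) (a 2)).withTransportedTorus g g' hgg' hg'g hgΩ))
    (hκ : κ ∈ torusT' ((PlaneData.mixedRow q (a 0) (a 2)).withTransportedTorus g g' hgg' hg'g hgΩ)) :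
    locEntry' q a g g' hgg' hg'g hgΩ lam hiso w (x * κ) 0 0 =
      locEntry' q a g g' hgg' hg'g hgΩ lam hiso w x 0 0 *
        weightAt' ((PlaneData.mixedRow q (a 0) (a 2)).withTransportedTorus g g' hgg' hg'g hgΩ) q w g g' 0 κ := by
  rw [weightAt'_eq_weightAt_conjTo q a g g' hgg' hg'g hgΩ lam hiso]
  unfold locEntry'
  rw [conjTo_mul]
  exact locEntry_mul_zero_zero_of_mem_torusT q (a 1) (a 3) (-1) w hw hcm ha1 ha3 (by norm_num) _ _
    (conjTo_mem_torusT_of_mem_torusT' q a g g' hgg' hg'g hgΩ lam hlam hiso hκ)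

include hlam in
/-- **`δ′(κ x) = u₁(κ) · δ′(x)`** for `κ ∈ T′(𝔸)`, `u₁ = weightAt' … 1` (the `(1,1)` law of `D3CoeffDelta` at the
conjugate). -/
theorem locEntry'_one_one_torus'_mul (hw : w.IsReal) (hcm : IsCMAt q w) (ha1 : a 1 ≠ 0) (ha3 : a 3 ≠ 0)
    (x κ : GA ((PlaneData.mixedRow q (a 0) (a 2)).withTransportedTorus g g' hgg' hg'g hgΩ))
    (hκ : κ ∈ torusT' ((PlaneData.mixedRow q (a 0) (a 2)).withTransportedTorus g g' hgg' hg'g hgΩ)) :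
    locEntry' q a g g' hgg' hg'g hgΩ lam hiso w (κ * x) 1 1 =
      weightAt' ((PlaneData.mixedRow q (a 0) (a 2)).withTransportedTorus g g' hgg' hg'g hgΩ) q w g g' 1 κ *
        locEntry' q a g g' hgg' hg'g hgΩ lam hiso w x 1 1 := by
  rw [weightAt'_eq_weightAt_conjTo q a g g' hgg' hg'g hgΩ lam hiso]
  unfold locEntry'
  rw [conjTo_mul]
  exact locEntry_one_one_mul_of_mem_torusT q (a 1) (a 3) (-1) w hw hcm ha1 ha3 (by norm_num) _ _
    (conjTo_mem_torusT_of_mem_torusT' q a g g' hgg' hg'g hgΩ lam hlam hiso hκ)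

include hlam in
/-- **`δ′(x κ) = δ′(x) · u₁(κ)`** for `κ ∈ T′(𝔸)`. -/
theorem locEntry'_one_one_mul_torus' (hw : w.IsReal) (hcm : IsCMAt q w) (ha1 : a 1 ≠ 0) (ha3 : a 3 ≠ 0)
    (x κ : GA ((PlaneData.mixedRow q (a 0) (a 2)).withTransportedTorus g g' hgg' hg'g hgΩ))
    (hκ : κ ∈ torusT' ((PlaneData.mixedRow q (a 0) (a 2)).withTransportedTorus g g' hgg' hg'g hgΩ)) :
    locEntry' q a g g' hgg' hg'g hgΩ lam hiso w (x * κ) 1 1 =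
      locEntry' q a g g' hgg' hg'g hgΩ lam hiso w x 1 1 *
        weightAt' ((PlaneData.mixedRow q (a 0) (a 2)).withTransportedTorus g g' hgg' hg'g hgΩ) q w g g' 1 κ := by
  rw [weightAt'_eq_weightAt_conjTo q a g g' hgg' hg'g hgΩ lam hiso]
  unfold locEntry'
  rw [conjTo_mul]
  exact locEntry_mul_one_one_of_mem_torusT q (a 1) (a 3) (-1) w hw hcm ha1 ha3 (by norm_num) _ _
    (conjTo_mem_torusT_of_mem_torusT' q a g g' hgg' hg'g hgΩ lam hlam hiso hκ)

include hlam hiso in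
/-- on `T′` the transported weight is unitary: `‖u_j(κ)‖ = 1` (RowWeights' `norm_weightAt_eq_one` at the conjugate). -/
theorem norm_weightAt'_eq_one_of_mem_torusT' (hw : w.IsReal) (hcm : IsCMAt q w) (ha1 : a 1 ≠ 0) (ha3 : a 3 ≠ 0)
    (j : Fin 2) {κ : GA ((PlaneData.mixedRow q (a 0) (a 2)).withTransportedTorus g g' hgg' hg'g hgΩ)}
    (hκ : κ ∈ torusT' ((PlaneData.mixedRow q (a 0) (a 2)).withTransportedTorus g g' hgg' hg'g hgΩ)) :
    ‖weightAt' ((PlaneData.mixedRow q (a 0) (a 2)).withTransportedTorus g g' hgg' hg'g hgΩ) q w g g' j κ‖ = 1 := by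
  rw [weightAt'_eq_weightAt_conjTo q a g g' hgg' hg'g hgΩ lam hiso]
  exact norm_weightAt_eq_one q (a 1) (a 3) (-1) w ha1 ha3 (by norm_num) hw hcm j
    (conjTo_mem_torusT_of_mem_torusT' q a g g' hgg' hg'g hgΩ lam hlam hiso hκ)

include hlam hiso in
/-- on `T′` the transported weight is non-zero. -/
theorem weightAt'_ne_zero_of_mem_torusT' (hw : w.IsReal) (hcm : IsCMAt q w) (ha1 : a 1 ≠ 0) (ha3 : a 3 ≠ 0)
    (j : Fin 2) {κ : GA ((PlaneData.mixedRow q (a 0) (a 2)).withTransportedTorus g g' hgg' hg'g hgΩ)}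
    (hκ : κ ∈ torusT' ((PlaneData.mixedRow q (a 0) (a 2)).withTransportedTorus g g' hgg' hg'g hgΩ)) :
    weightAt' ((PlaneData.mixedRow q (a 0) (a 2)).withTransportedTorus g g' hgg' hg'g hgΩ) q w g g' j κ ≠ 0 := by
  intro h0
  have h := norm_weightAt'_eq_one_of_mem_torusT' q a g g' hgg' hg'g hgΩ lam hlam hiso w hw hcm ha1 ha3 j hκ
  rw [h0, norm_zero] at h
  exact zero_ne_one h

/-- **the `(p, m)`-weight coefficient at `w`** in the `T′`-adapted coordinates:
`wtMono p α′(x) · wtMono m δ′(x) = conj(α′)^{p₊} (α′)^{p₋} · conj(δ′)^{m₊} (δ′)^{m₋}` with `α′ = locEntry' x 0 0`,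
`δ′ = locEntry' x 1 1` — the `(eP′ w, eM′ w) = (p, m)` factor of the archimedean witness at a definite place `w ≠ w₀`. -/
def defCoeff (p m : ℤ) (x : GA ((PlaneData.mixedRow q (a 0) (a 2)).withTransportedTorus g g' hgg' hg'g hgΩ)) : ℂ :=
  wtMono p (locEntry' q a g g' hgg' hg'g hgΩ lam hiso w x 0 0) *
    wtMono m (locEntry' q a g g' hgg' hg'g hgΩ lam hiso w x 1 1)

/-- `defCoeff w p m 1 = 1`. -/
theorem defCoeff_one (p m : ℤ) : defCoeff q a g g' hgg' hg'g hgΩ lam hiso w p m 1 = 1 := by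
  have h : ∀ j : Fin 2, locEntry' q a g g' hgg' hg'g hgΩ lam hiso w 1 j j = 1 := by
    intro j
    rw [← locMat'_apply, locMat'_one]
    simp
  unfold defCoeff
  rw [h 0, h 1, wtMono_one, wtMono_one, mul_one]

/-- **`defCoeff w p m` is continuous** (no sign hypothesis: `locEntry'` is continuous). -/
theorem continuous_defCoeff (p m : ℤ) : Continuous (defCoeff q a g g' hgg' hg'g hgΩ lam hiso w p m) :=
  ((continuous_wtMono p).comp (continuous_locEntry' q a g g' hgg' hg'g hgΩ lam hiso w 0 0)).mul
    ((continuous_wtMono m).comp (continuous_locEntry' q a g g' hgg' hg'g hgΩ lam hiso w 1 1))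

/-- **the bound `‖defCoeff w p m x‖ ≤ 1` at a DEFINITE place** (`(a 1)_w · (−a 3)_w > 0`: the `w`-block of `g′ x g` is
in the compact `U(2)`, `‖α′‖, ‖δ′‖ ≤ 1` by `normSq_locEntry_le_of_definite`), uniformly in `x`. -/
theorem norm_defCoeff_le_one (hw : w.IsReal) (hcm : IsCMAt q w)
    (hdef : 0 < (adToC w (algebraMap k (Ad k) (a 1))).re * (adToC w (algebraMap k (Ad k) (-1 * a 3))).re)
    (p m : ℤ) (x : GA ((PlaneData.mixedRow q (a 0) (a 2)).withTransportedTorus g g' hgg' hg'g hgΩ)) :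
    ‖defCoeff q a g g' hgg' hg'g hgΩ lam hiso w p m x‖ ≤ 1 := by
  obtain ⟨h00, -, -, h11⟩ :=
    normSq_locEntry_le_of_definite q (a 1) (a 3) (-1) w hw hcm hdef (conjTo q a g g' hgg' hg'g hgΩ lam hiso x)
  rw [Complex.normSq_eq_norm_sq] at h00 h11
  have n00 : ‖locEntry' q a g g' hgg' hg'g hgΩ lam hiso w x 0 0‖ ≤ 1 :=
    (pow_le_one_iff_of_nonneg (norm_nonneg _) two_ne_zero).1 h00
  have n11 : ‖locEntry' q a g g' hgg' hg'g hgΩ lam hiso w x 1 1‖ ≤ 1 :=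
    (pow_le_one_iff_of_nonneg (norm_nonneg _) two_ne_zero).1 h11
  unfold defCoeff
  rw [norm_mul]
  exact mul_le_one₀ (norm_wtMono_le_one p n00) (norm_nonneg _) (norm_wtMono_le_one m n11)

include hlam in
/-- **THE `T′`-EQUIVARIANCE LAW (left)**: `defCoeff w p m (κ x) = u₀(κ)^{−p} · u₁(κ)^{−m} · defCoeff w p m x` for
`κ ∈ T′(𝔸)` (`wtMono_unit_mul` on each diagonal coordinate; the weights are unitary on the torus). -/
theorem defCoeff_torus'_mul (hw : w.IsReal) (hcm : IsCMAt q w) (ha1 : a 1 ≠ 0) (ha3 : a 3 ≠ 0) (p m : ℤ)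
    (x κ : GA ((PlaneData.mixedRow q (a 0) (a 2)).withTransportedTorus g g' hgg' hg'g hgΩ))
    (hκ : κ ∈ torusT' ((PlaneData.mixedRow q (a 0) (a 2)).withTransportedTorus g g' hgg' hg'g hgΩ)) :
    defCoeff q a g g' hgg' hg'g hgΩ lam hiso w p m (κ * x) =
      weightAt' ((PlaneData.mixedRow q (a 0) (a 2)).withTransportedTorus g g' hgg' hg'g hgΩ) q w g g' 0 κ ^ (-p) *
        weightAt' ((PlaneData.mixedRow q (a 0) (a 2)).withTransportedTorus g g' hgg' hg'g hgΩ) q w g g' 1 κ ^ (-m) *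
        defCoeff q a g g' hgg' hg'g hgΩ lam hiso w p m x := by
  have hu0 := conj_weightAt'_of_mem_torusT' q a g g' hgg' hg'g hgΩ lam hlam hiso w hw hcm ha1 ha3 0 hκ
  have hu1 := conj_weightAt'_of_mem_torusT' q a g g' hgg' hg'g hgΩ lam hlam hiso w hw hcm ha1 ha3 1 hκ
  have hn0 := weightAt'_ne_zero_of_mem_torusT' q a g g' hgg' hg'g hgΩ lam hlam hiso w hw hcm ha1 ha3 0 hκ
  have hn1 := weightAt'_ne_zero_of_mem_torusT' q a g g' hgg' hg'g hgΩ lam hlam hiso w hw hcm ha1 ha3 1 hκ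
  unfold defCoeff
  rw [locEntry'_zero_zero_torus'_mul q a g g' hgg' hg'g hgΩ lam hlam hiso w hw hcm ha1 ha3 x κ hκ,
    locEntry'_one_one_torus'_mul q a g g' hgg' hg'g hgΩ lam hlam hiso w hw hcm ha1 ha3 x κ hκ,
    wtMono_unit_mul p hu0 hn0, wtMono_unit_mul m hu1 hn1]
  ring

include hlam in
/-- **THE `T′`-EQUIVARIANCE LAW (right)**: `defCoeff w p m (x κ) = u₀(κ)^{−p} · u₁(κ)^{−m} · defCoeff w p m x` for
`κ ∈ T′(𝔸)`. -/
theorem defCoeff_mul_torus' (hw : w.IsReal) (hcm : IsCMAt q w) (ha1 : a 1 ≠ 0) (ha3 : a 3 ≠ 0) (p m : ℤ)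
    (x κ : GA ((PlaneData.mixedRow q (a 0) (a 2)).withTransportedTorus g g' hgg' hg'g hgΩ))
    (hκ : κ ∈ torusT' ((PlaneData.mixedRow q (a 0) (a 2)).withTransportedTorus g g' hgg' hg'g hgΩ)) :
    defCoeff q a g g' hgg' hg'g hgΩ lam hiso w p m (x * κ) =
      weightAt' ((PlaneData.mixedRow q (a 0) (a 2)).withTransportedTorus g g' hgg' hg'g hgΩ) q w g g' 0 κ ^ (-p) *
        weightAt' ((PlaneData.mixedRow q (a 0) (a 2)).withTransportedTorus g g' hgg' hg'g hgΩ) q w g g' 1 κ ^ (-m) *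
        defCoeff q a g g' hgg' hg'g hgΩ lam hiso w p m x := by
  have hu0 := conj_weightAt'_of_mem_torusT' q a g g' hgg' hg'g hgΩ lam hlam hiso w hw hcm ha1 ha3 0 hκ
  have hu1 := conj_weightAt'_of_mem_torusT' q a g g' hgg' hg'g hgΩ lam hlam hiso w hw hcm ha1 ha3 1 hκ
  have hn0 := weightAt'_ne_zero_of_mem_torusT' q a g g' hgg' hg'g hgΩ lam hlam hiso w hw hcm ha1 ha3 0 hκ
  have hn1 := weightAt'_ne_zero_of_mem_torusT' q a g g' hgg' hg'g hgΩ lam hlam hiso w hw hcm ha1 ha3 1 hκ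
  unfold defCoeff
  rw [locEntry'_zero_zero_mul_torus' q a g g' hgg' hg'g hgΩ lam hlam hiso w hw hcm ha1 ha3 x κ hκ,
    locEntry'_one_one_mul_torus' q a g g' hgg' hg'g hgΩ lam hlam hiso w hw hcm ha1 ha3 x κ hκ, mul_comm _ (weightAt' _ _ _ _ _ 0 κ),
    mul_comm _ (weightAt' _ _ _ _ _ 1 κ), wtMono_unit_mul p hu0 hn0, wtMono_unit_mul m hu1 hn1]
  ring

include hlam in
/-- **THE `equiv` FIELD OF `IsArchCoeff` AT `w` WITH `(eP′ w, eM′ w) = (p, m)`**: for `κ` in the local torus `T′_w` and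
every `y`, `RTF.cj (defCoeff w p m) (κ⁻¹ y) = u₀(κ) ^ (−p) · u₁(κ) ^ (−m) · RTF.cj (defCoeff w p m) y` — the left
`(T′_w, (−p, −m))`-equivariance of the conjugate coefficient, the clause of `IsArchCoeff.equiv` verbatim for ARBITRARY
displayed integers `p m` (`u(κ⁻¹) = u(κ)⁻¹`, `conj u = u⁻¹` on the unitary torus weights). -/
theorem cj_defCoeff_inv_mul (hw : w.IsReal) (hcm : IsCMAt q w) (ha1 : a 1 ≠ 0) (ha3 : a 3 ≠ 0) (p m : ℤ)
    {κ : GA ((PlaneData.mixedRow q (a 0) (a 2)).withTransportedTorus g g' hgg' hg'g hgΩ)}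
    (hκ : κ ∈ localTorusAt' ((PlaneData.mixedRow q (a 0) (a 2)).withTransportedTorus g g' hgg' hg'g hgΩ) w)
    (y : GA ((PlaneData.mixedRow q (a 0) (a 2)).withTransportedTorus g g' hgg' hg'g hgΩ)) :
    RTF.cj (defCoeff q a g g' hgg' hg'g hgΩ lam hiso w p m) (κ⁻¹ * y) =
      weightAt' ((PlaneData.mixedRow q (a 0) (a 2)).withTransportedTorus g g' hgg' hg'g hgΩ) q w g g' 0 κ ^ (-p) *
        weightAt' ((PlaneData.mixedRow q (a 0) (a 2)).withTransportedTorus g g' hgg' hg'g hgΩ) q w g g' 1 κ ^ (-m) *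
        RTF.cj (defCoeff q a g g' hgg' hg'g hgΩ lam hiso w p m) y := by
  have hκT : κ ∈ torusT' ((PlaneData.mixedRow q (a 0) (a 2)).withTransportedTorus g g' hgg' hg'g hgΩ) := hκ.1
  have hκT' : κ⁻¹ ∈ torusT' ((PlaneData.mixedRow q (a 0) (a 2)).withTransportedTorus g g' hgg' hg'g hgΩ) :=
    (torusT' _).inv_mem hκT
  have hu0 := conj_weightAt'_of_mem_torusT' q a g g' hgg' hg'g hgΩ lam hlam hiso w hw hcm ha1 ha3 0 hκT
  have hu1 := conj_weightAt'_of_mem_torusT' q a g g' hgg' hg'g hgΩ lam hlam hiso w hw hcm ha1 ha3 1 hκT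
  unfold RTF.cj
  rw [defCoeff_torus'_mul q a g g' hgg' hg'g hgΩ lam hlam hiso w hw hcm ha1 ha3 p m y κ⁻¹ hκT',
    weightAt'_inv_of_mem_torusT' q a g g' hgg' hg'g hgΩ lam hlam hiso w hw hcm ha1 ha3 0 hκT,
    weightAt'_inv_of_mem_torusT' q a g g' hgg' hg'g hgΩ lam hlam hiso w hw hcm ha1 ha3 1 hκT,
    _root_.inv_zpow', _root_.inv_zpow', neg_neg, neg_neg, map_mul, map_mul, map_zpow₀, map_zpow₀, hu0, hu1,
    _root_.inv_zpow', _root_.inv_zpow']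

include hlam in
/-- **the local tori of the OTHER places act trivially on the `T′`-adapted coordinates at `w`**: for
`κ ∈ T′_{w′}` with `w′ ≠ w`, the `w`-block of `g′ κ g` is the identity (`IsAtPlace` is preserved by the conjugation), so
`locEntry' w (κ x) I J = locEntry' w x I J`. -/
theorem locEntry'_mul_of_mem_localTorusAt'_ne (hw : w.IsReal) (hcm : IsCMAt q w) {w' : InfinitePlace k}
    (hne : w' ≠ w)
    {κ : GA ((PlaneData.mixedRow q (a 0) (a 2)).withTransportedTorus g g' hgg' hg'g hgΩ)}
    (hκ : κ ∈ localTorusAt' ((PlaneData.mixedRow q (a 0) (a 2)).withTransportedTorus g g' hgg' hg'g hgΩ) w')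
    (x : GA ((PlaneData.mixedRow q (a 0) (a 2)).withTransportedTorus g g' hgg' hg'g hgΩ)) (I J : Fin 2) :
    locEntry' q a g g' hgg' hg'g hgΩ lam hiso w (κ * x) I J = locEntry' q a g g' hgg' hg'g hgΩ lam hiso w x I J := by
  have hat : IsAtPlace (PlaneData.ofLinesRow q (a 1) (a 3) (-1)) w' (conjTo q a g g' hgg' hg'g hgΩ lam hiso κ) :=
    (conjTo_mem_localTorusAt_of_mem_localTorusAt' q a g g' hgg' hg'g hgΩ lam hlam hiso w' hκ).2
  have hcomp : GA.infiniteComponent (PlaneData.ofLinesRow q (a 1) (a 3) (-1)) w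
      (conjTo q a g g' hgg' hg'g hgΩ lam hiso κ) = 1 := hat.2 w hne.symm
  have hone : locMat q (a 1) (a 3) (-1) w (conjTo q a g g' hgg' hg'g hgΩ lam hiso κ) = 1 := by
    funext I J
    rw [locMat_apply, locEntry, entryAt, entryAt, hcomp]
    fin_cases I <;> fin_cases J <;> simp [lineBase, lineOmega]
  unfold locEntry'
  rw [conjTo_mul]
  have hmul := congrFun (congrFun (locMat_mul q (a 1) (a 3) (-1) w hw hcm
    (conjTo q a g g' hgg' hg'g hgΩ lam hiso κ) (conjTo q a g g' hgg' hg'g hgΩ lam hiso x)) I) J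
  rw [hone, one_mul, locMat_apply, locMat_apply] at hmul
  exact hmul

include hlam in
/-- **the other places act trivially on `defCoeff w`**: for `κ ∈ T′_{w′}` with `w′ ≠ w`,
`defCoeff w p m (κ x) = defCoeff w p m x` — the `equiv` clause of the `w`-factor at every place `w′ ≠ w` (weights
`(0, 0)` there; the `w′`-factor of the witness carries the weights of `w′`). -/
theorem defCoeff_mul_of_mem_localTorusAt'_ne (hw : w.IsReal) (hcm : IsCMAt q w) {w' : InfinitePlace k}
    (hne : w' ≠ w) (p m : ℤ)
    {κ : GA ((PlaneData.mixedRow q (a 0) (a 2)).withTransportedTorus g g' hgg' hg'g hgΩ)}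
    (hκ : κ ∈ localTorusAt' ((PlaneData.mixedRow q (a 0) (a 2)).withTransportedTorus g g' hgg' hg'g hgΩ) w')
    (x : GA ((PlaneData.mixedRow q (a 0) (a 2)).withTransportedTorus g g' hgg' hg'g hgΩ)) :
    defCoeff q a g g' hgg' hg'g hgΩ lam hiso w p m (κ * x) = defCoeff q a g g' hgg' hg'g hgΩ lam hiso w p m x := by
  unfold defCoeff
  rw [locEntry'_mul_of_mem_localTorusAt'_ne q a g g' hgg' hg'g hgΩ lam hlam hiso w hw hcm hne hκ x 0 0,
    locEntry'_mul_of_mem_localTorusAt'_ne q a g g' hgg' hg'g hgΩ lam hlam hiso w hw hcm hne hκ x 1 1]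

include hlam in
/-- **the `equiv` field of `IsArchCoeff` at the OTHER places `w′ ≠ w` for the `w`-factor, in the displayed shape with
the weights `(0, 0)`** (APPEND by t4-L4-p1 g4 on the lead's (R-33) S15163: the `cj`-form of
`defCoeff_mul_of_mem_localTorusAt'_ne`): for `κ ∈ T′_{w′}` and every `y`,
`cj defCoeff (κ⁻¹ y) = weightAt' … w′ 0 κ ^ (−0) · weightAt' … w′ 1 κ ^ (−0) · cj defCoeff y`. -/
theorem cj_defCoeff_inv_mul_ne (hw : w.IsReal) (hcm : IsCMAt q w) {w' : InfinitePlace k} (hne : w' ≠ w) (p m : ℤ)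
    {κ : GA ((PlaneData.mixedRow q (a 0) (a 2)).withTransportedTorus g g' hgg' hg'g hgΩ)}
    (hκ : κ ∈ localTorusAt' ((PlaneData.mixedRow q (a 0) (a 2)).withTransportedTorus g g' hgg' hg'g hgΩ) w')
    (y : GA ((PlaneData.mixedRow q (a 0) (a 2)).withTransportedTorus g g' hgg' hg'g hgΩ)) :
    RTF.cj (defCoeff q a g g' hgg' hg'g hgΩ lam hiso w p m) (κ⁻¹ * y) =
      weightAt' ((PlaneData.mixedRow q (a 0) (a 2)).withTransportedTorus g g' hgg' hg'g hgΩ) q w' g g' 0 κ ^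
          (-(0 : ℤ)) *
        weightAt' ((PlaneData.mixedRow q (a 0) (a 2)).withTransportedTorus g g' hgg' hg'g hgΩ) q w' g g' 1 κ ^
          (-(0 : ℤ)) *
        RTF.cj (defCoeff q a g g' hgg' hg'g hgΩ lam hiso w p m) y := by
  unfold RTF.cj
  rw [defCoeff_mul_of_mem_localTorusAt'_ne q a g g' hgg' hg'g hgΩ lam hlam hiso w hw hcm hne p m
    ((localTorusAt' _ w').inv_mem hκ) y, neg_zero, zpow_zero, zpow_zero, one_mul, one_mul]

end DefCoeff

end Summit.Ventures.HodgeRepro.Tier4.Line4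

end
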